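import Literature.Geometry.Lorentzian.KerrRedShiftEstimate
import HarnessLib

/-!
# The red-shift estimate for horizon-regular solutions of the Kerr wave equation through admissible
# leaves (Dafermos–Rodnianski–Shlapentokh-Rothman, §13.2, first display)

(family `gr`; namespace `Literature.Geometry.Lorentzian`; written from the proving seat of the named
fact `DafermosRodnianskiShlapentokhRothman2016_energyBoundedness_horizonRegular`
(`KerrHorizonRegularWaveBoundedness.lean`); no definitions, no named facts.)

`kerr_horizonRegular_redShift_estimate` restates the coordinate red-shift estimate
`Kerr.redShift_estimate` (`KerrRedShiftEstimate.lean`) for the class of solutions of the named fact: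
smooth `ψ : Kerr.region a r₀ → ℝ` (`r₀ ≤ r₊`, a chart neighbourhood of `{r ≥ r₊}`) solving
`□_{g_{M,a}} ψ = 0` at the points with `r > r₊`, and the leaves `Σ̃_u = {t* = u + F}` of an
admissible height function `F` (`Kerr.IsAdmissibleHeight`), with the radially localised energies
written as `graphSliceEnergyOn` (`KerrWaveEnergy.lean`) of the restriction of `ψ` to the exterior:
for every `0 < η ≤ η₀(M, a)` and `C = C(M, a, η, F) < ∞`,

  `E_F(s; r ≤ r₊ + η/2) + ∫_0^s E_F(u; r ≤ r₊ + η/2) du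
      ≤ C · (E_F(0; r ≤ r₊ + η) + ∫_0^s E_F(u; r₊ + η/2 ≤ r ≤ r₊ + η) du)`     (`s ≥ 0`),

which is the first inequality of the first display of arXiv:1402.7034, §13.2 (the red-shift
estimate Prop. 4.5.2 applied between `Σ̃_0` and `Σ̃_s`), for the foliations of §3.3.

## References

* M. Dafermos, I. Rodnianski, Y. Shlapentokh-Rothman, Ann. of Math. 183 (2016), arXiv:1402.7034,
  §3.3, Prop. 4.5.2, §13.2 (key `DafermosRodnianskiShlapentokhrothman2014`).
* M. Dafermos, I. Rodnianski, arXiv:0811.0354, §3.3.3, Thm. 7.1 (key `DafermosRodnianski2008`).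
-/

noncomputable section

open Set Filter Metric MeasureTheory
open scoped Topology Manifold ContDiff ENNReal

namespace Literature.Geometry.Lorentzian

/-- **The red-shift estimate for horizon-regular solutions through admissible leaves** (DRSR
arXiv:1402.7034, §13.2, first display, first inequality; Prop. 4.5.2). For subextremal `(M, a)` and
`r₀ ≤ r₊` there is `η₀ > 0` such that for every collar width `0 < η ≤ η₀` and every admissible
height function `F` there is `C < ∞` with:
for every smooth `ψ : Kerr.region a r₀ → ℝ` solving `□_g ψ = 0` at the points with `r > r₊` and
every `s ≥ 0`,
`E(s; {r ≤ r₊ + η/2}) + ∫_{(0,s]} E(u; {r ≤ r₊ + η/2}) du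
  ≤ C (E(0; {r ≤ r₊ + η}) + ∫_{(0,s]} E(u; {r₊ + η/2 ≤ r ≤ r₊ + η}) du)`,
where `E(u; S) = graphSliceEnergyOn (Kerr.exterior M a) ψ|_{r > r₊} F u {y | r(u + F(y), y) ∈ S}` is
the coordinate energy through `Σ̃_u ∩ {r > r₊} = {t* = u + F}` restricted radially. Proof:
`Kerr.redShift_estimate` for the representative of `ψ` (`Kerr.dalembertian_eq_waveOperator`).
[cite: DafermosRodnianskiShlapentokhrothman2014, Prop. 4.5.2 and §13.2] -/
theorem kerr_horizonRegular_redShift_estimate [Kerr.Facts] [Kerr.SliceFacts]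
    {M a r₀ : ℝ} (hMa : Kerr.IsSubextremal M a) (hr : r₀ ≤ Kerr.rPlus M a) :
    ∃ η₀ : ℝ, 0 < η₀ ∧ ∀ η : ℝ, 0 < η → η ≤ η₀ → ∀ F : E3 → ℝ, Kerr.IsAdmissibleHeight M F →
      ∃ C : ℝ≥0∞, C < ⊤ ∧ ∀ ψ : Kerr.region a r₀ → ℝ,
        ContMDiff 𝓘(ℝ, E4) 𝓘(ℝ, ℝ) ∞ ψ →
        (∀ x : Kerr.region a r₀, Kerr.rPlus M a < Kerr.radius a (x : E4) →
          (Kerr.smoothMetric M a r₀).toPseudoRiemannianMetric.dalembertian ψ x = 0) →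
        ∀ s : ℝ, 0 ≤ s →
          graphSliceEnergyOn (Kerr.exterior M a)
              (fun y : Kerr.exterior M a ↦ ψ ⟨(y : E4), Kerr.region_mono a hr y.2⟩) F s
              {y | Kerr.radius a (E4.ofTimeSpace (s + F y) y) ≤ Kerr.rPlus M a + η / 2} +
            ∫⁻ u in Set.Ioc 0 s, graphSliceEnergyOn (Kerr.exterior M a)
              (fun y : Kerr.exterior M a ↦ ψ ⟨(y : E4), Kerr.region_mono a hr y.2⟩) F u
              {y | Kerr.radius a (E4.ofTimeSpace (u + F y) y) ≤ Kerr.rPlus M a + η / 2} ≤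
          C * (graphSliceEnergyOn (Kerr.exterior M a)
                (fun y : Kerr.exterior M a ↦ ψ ⟨(y : E4), Kerr.region_mono a hr y.2⟩) F 0
                {y | Kerr.radius a (E4.ofTimeSpace (0 + F y) y) ≤ Kerr.rPlus M a + η} +
              ∫⁻ u in Set.Ioc 0 s, graphSliceEnergyOn (Kerr.exterior M a)
                (fun y : Kerr.exterior M a ↦ ψ ⟨(y : E4), Kerr.region_mono a hr y.2⟩) F u
                {y | Kerr.rPlus M a + η / 2 ≤ Kerr.radius a (E4.ofTimeSpace (u + F y) y) ∧
                  Kerr.radius a (E4.ofTimeSpace (u + F y) y) ≤ Kerr.rPlus M a + η}) := by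
  obtain ⟨η₀, hη₀, h₀⟩ := Kerr.redShift_estimate hMa
  have hrp : 0 < Kerr.rPlus M a := hMa.rPlus_pos
  refine ⟨η₀, hη₀, fun η hη hηle F hF ↦ ?_⟩
  obtain ⟨C, hC, h⟩ := h₀ η hη hηle
  obtain ⟨c, hc, hc1, hslope⟩ := hF.exists_slope_le'
  have hF2 : ContDiff ℝ 2 F := hF.contDiff.of_le (WithTop.coe_le_coe.mpr le_top)
  refine ⟨ENNReal.ofReal (C / c), ENNReal.ofReal_lt_top, fun ψ hψ hwave s hs ↦ ?_⟩
  set ψ' : Kerr.exterior M a → ℝ := fun y ↦ ψ ⟨(y : E4), Kerr.region_mono a hr y.2⟩ with hψ'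
  set Φ : E4 → ℝ := Function.extend Subtype.val ψ 0 with hΦ
  set Φ' : E4 → ℝ := Function.extend Subtype.val ψ' 0 with hΦ'
  have hrep : ∀ y, ψ y = Φ y := extend_rep ψ
  have hrep' : ∀ y, ψ' y = Φ' y := extend_rep ψ'
  have hagree : ∀ z ∈ (Kerr.exterior M a : Set E4), Φ' =ᶠ[𝓝 z] Φ := by
    intro z hz
    filter_upwards [(Kerr.exterior M a).isOpen.mem_nhds hz] with w hw
    rw [← hrep' ⟨w, hw⟩, ← hrep ⟨w, Kerr.region_mono a hr hw⟩]
  have hΦ2 : ∀ z ∈ (Kerr.exterior M a : Set E4), ContDiffAt ℝ 2 Φ z := fun z hz ↦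
    (contDiffAt_extend hψ ⟨z, Kerr.region_mono a hr hz⟩).of_le (WithTop.coe_le_coe.mpr le_top)
  have hsol : ∀ z ∈ (Kerr.exterior M a : Set E4),
      KerrSchild.waveOperator (KerrSchild.inverseMetric (fun y ↦ 2 * Kerr.scalarH M a y)
        (Kerr.nullVector a)) Φ z = 0 := by
    intro z hz
    rw [← Kerr.dalembertian_eq_waveOperator M a r₀ hrep ⟨z, Kerr.region_mono a hr hz⟩ (hΦ2 z hz)]
    exact hwave _ (Kerr.lt_radius_of_mem_region hz)
  -- the graph maps are continuous; the radial sets are measurable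
  have hgraph : ∀ t : ℝ, Continuous fun y : E3 ↦ E4.ofTimeSpace (t + F y) y := fun t ↦
    E4.continuous_ofTimeSpace' (continuous_const.add hF2.continuous) continuous_id
  have hrc : ∀ t : ℝ, Continuous fun y : E3 ↦ Kerr.radius a (E4.ofTimeSpace (t + F y) y) :=
    fun t ↦ (Kerr.continuous_radius a).comp (hgraph t)
  -- the restricted energies as integrals over `E3` with indicators
  have hE : ∀ (t : ℝ) (S : Set E3), MeasurableSet S →
      graphSliceEnergyOn (Kerr.exterior M a) ψ' F t S =
        ∫⁻ y, (S ∩ {y : E3 | E4.ofTimeSpace (t + F y) y ∈ Kerr.exterior M a}).indicator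
          (fun y ↦ ENNReal.ofReal
            (∑ μ, fderiv ℝ Φ (E4.ofTimeSpace (t + F y) y) (E4.basisVector μ) ^ 2)) y := by
    intro t S hS
    unfold graphSliceEnergyOn
    rw [← lintegral_indicator hS]
    refine lintegral_congr fun y ↦ ?_
    rw [Set.indicator_indicator]
    by_cases hy : y ∈ S ∩ {y : E3 | E4.ofTimeSpace (t + F y) y ∈ Kerr.exterior M a}
    · rw [indicator_of_mem hy, indicator_of_mem hy, ← Kerr.sum_sq_fderiv_extend_eq,
        (hagree _ hy.2).fderiv_eq]
    · rw [indicator_of_notMem hy, indicator_of_notMem hy]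
  have hmem : ∀ (t : ℝ) (y : E3), E4.ofTimeSpace (t + F y) y ∈ Kerr.exterior M a ↔
      Kerr.rPlus M a < Kerr.radius a (E4.ofTimeSpace (t + F y) y) := by
    intro t y
    rw [← SetLike.mem_coe]
    show E4.ofTimeSpace (t + F y) y ∈ (Kerr.exterior M a : Set E4) ↔ _
    rw [SetLike.mem_coe, Kerr.mem_exterior, max_eq_left hrp.le]
  -- the four terms
  have h1 : ∀ (t R : ℝ), graphSliceEnergyOn (Kerr.exterior M a) ψ' F t
      {y | Kerr.radius a (E4.ofTimeSpace (t + F y) y) ≤ R} =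
      ∫⁻ y, {y : E3 | Kerr.rPlus M a < Kerr.radius a (E4.ofTimeSpace (t + F y) y) ∧
          Kerr.radius a (E4.ofTimeSpace (t + F y) y) ≤ R}.indicator
        (fun y ↦ ENNReal.ofReal
          (∑ μ, fderiv ℝ Φ (E4.ofTimeSpace (t + F y) y) (E4.basisVector μ) ^ 2)) y := by
    intro t R
    have hset : {y | Kerr.radius a (E4.ofTimeSpace (t + F y) y) ≤ R} ∩
        {y : E3 | E4.ofTimeSpace (t + F y) y ∈ Kerr.exterior M a} =
        {y : E3 | Kerr.rPlus M a < Kerr.radius a (E4.ofTimeSpace (t + F y) y) ∧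
          Kerr.radius a (E4.ofTimeSpace (t + F y) y) ≤ R} := by
      ext y
      simp only [Set.mem_inter_iff, Set.mem_setOf_eq, hmem]
      tauto
    rw [hE t _ (isClosed_le (hrc t) continuous_const).measurableSet, hset]
  have h2 : ∀ (t R R' : ℝ), Kerr.rPlus M a < R → graphSliceEnergyOn (Kerr.exterior M a) ψ' F t
      {y | R ≤ Kerr.radius a (E4.ofTimeSpace (t + F y) y) ∧
        Kerr.radius a (E4.ofTimeSpace (t + F y) y) ≤ R'} =
      ∫⁻ y, {y : E3 | R ≤ Kerr.radius a (E4.ofTimeSpace (t + F y) y) ∧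
          Kerr.radius a (E4.ofTimeSpace (t + F y) y) ≤ R'}.indicator
        (fun y ↦ ENNReal.ofReal
          (∑ μ, fderiv ℝ Φ (E4.ofTimeSpace (t + F y) y) (E4.basisVector μ) ^ 2)) y := by
    intro t R R' hR
    have hm : MeasurableSet {y : E3 | R ≤ Kerr.radius a (E4.ofTimeSpace (t + F y) y) ∧
        Kerr.radius a (E4.ofTimeSpace (t + F y) y) ≤ R'} := by
      rw [Set.setOf_and]
      exact ((isClosed_le continuous_const (hrc t)).inter
        (isClosed_le (hrc t) continuous_const)).measurableSet
    have hset : {y | R ≤ Kerr.radius a (E4.ofTimeSpace (t + F y) y) ∧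
        Kerr.radius a (E4.ofTimeSpace (t + F y) y) ≤ R'} ∩
        {y : E3 | E4.ofTimeSpace (t + F y) y ∈ Kerr.exterior M a} =
        {y : E3 | R ≤ Kerr.radius a (E4.ofTimeSpace (t + F y) y) ∧
          Kerr.radius a (E4.ofTimeSpace (t + F y) y) ≤ R'} := by
      ext y
      simp only [Set.mem_inter_iff, Set.mem_setOf_eq, hmem]
      constructor
      · exact fun hy ↦ hy.1
      · exact fun hy ↦ ⟨hy, hR.trans_le hy.1⟩
    rw [hE t _ hm, hset]
  have hR₁ : Kerr.rPlus M a < Kerr.rPlus M a + η / 2 := by linarith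
  rw [h1 s, h1 0, lintegral_congr (fun u ↦ h1 u (Kerr.rPlus M a + η / 2)),
    lintegral_congr (fun u ↦ h2 u _ (Kerr.rPlus M a + η) hR₁)]
  exact h F c hF2 hc hc1 hslope Φ hΦ2 hsol s hs

end Literature.Geometry.Lorentzian
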